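import Summits.Ventures.PercRepro.S2SetCountQuart
import Summits.Ventures.PercRepro.S2DichotomyTools

/-!
# PercRepro — S2: THE MAXIMAL EXTENSIONS OF A FLAT (p7, gen 13; sub-claim S2; the cells `(14, 8 … 11)`)

In the case `k` of the nested dichotomy every rank-`5` set has `≤ f = 5 + k` points, and the kit's partition count weighs EVERY
spanning `6`-set `S` by `C(f − 6, j)` — the number of rank-`5` `(6 + j)`-supersets inside the largest possible closure. The sets
whose closure is MAXIMAL (`|cl S| = f`) are few: for a rank-`r` flat `P` of `q` points the flats `cl(P ∪ x)`, `x ∉ P`, partition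
`E ∖ P` into blocks `F ∖ P`; a maximal block has `α = f − q` points, and `t` maximal blocks span a set of `q + tα` points and rank
`≤ r + t`, of nullity `≥ (q − r) + t(α − 1)`, which is `≤ d = ν(E)`:
**`card_maxExt_le`** — `#{x ∈ E ∖ P : |cl(P ∪ x)| = f} ≤ α·⌊(d + r − q)/(α − 1)⌋`.
(`card_maxExt_eq_mul`: the block structure; `card_maxExt_le_ncard_diff`: the trivial bound `|E ∖ P|`). The double counting that
lifts it to the spanning `6`-sets through the circuits of `5`, `4` and `3` points is S2MaxExtensionPairs, the assembly S2MaxExtensionCount.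
Axioms: standard.
-/

open scoped Matroid

namespace PercRepro

namespace S2

open Set Finset

variable {α : Type} {M : Matroid α}

/-- Membership in `maxExt`. -/
theorem mem_maxExt {P : Set α} {f : ℕ} {x : α} :
    x ∈ {x ∈ M.E \ P | (M.closure (insert x P)).ncard = f} ↔ x ∈ M.E ∧ x ∉ P ∧ (M.closure (insert x P)).ncard = f := by
  simp only [Set.mem_setOf_eq, Set.mem_sdiff]
  tauto

/-- `{x ∈ M.E \ P | (M.closure (insert x P)).ncard = f} ⊆ E ∖ P`. -/
theorem maxExt_subset (P : Set α) (f : ℕ) : {x ∈ M.E \ P | (M.closure (insert x P)).ncard = f} ⊆ M.E \ P := fun _ hx => by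
  obtain ⟨h1, h2, -⟩ := mem_maxExt.1 hx
  exact ⟨h1, h2⟩

/-- `{x ∈ M.E \ P | (M.closure (insert x P)).ncard = f} ⊆ E`. -/
theorem maxExt_subset_ground (P : Set α) (f : ℕ) : {x ∈ M.E \ P | (M.closure (insert x P)).ncard = f} ⊆ M.E :=
  (maxExt_subset P f).trans Set.sdiff_subset

/-- `M.eRk P` is finite on a finite matroid. -/
theorem eRk_ne_top_of_finite [M.Finite] {P : Set α} (hPE : P ⊆ M.E) : M.eRk P ≠ ⊤ :=
  ne_top_of_lt ((M.eRk_le_encard P).trans_lt (M.ground_finite.subset hPE).encard_lt_top)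

/-- **Points of one block have the same closure**: for a flat `P` and `x ∉ P`, every `y ∈ cl(P ∪ x) ∖ P` has
`cl(P ∪ y) = cl(P ∪ x)`. -/
theorem closure_insert_eq_of_mem_closure_insert [M.Finite] {P : Set α} (hPE : P ⊆ M.E) (hP : M.closure P = P)
    {x y : α} (hx : x ∈ M.E) (hxP : x ∉ P) (hy : y ∈ M.closure (insert x P)) (hyP : y ∉ P) :
    M.closure (insert y P) = M.closure (insert x P) := by
  have hyE : y ∈ M.E := M.closure_subset_ground _ hy
  have hsub : M.closure (insert y P) ⊆ M.closure (insert x P) := by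
    apply M.closure_subset_closure_of_subset_closure
    intro z hz
    rcases hz with rfl | hz
    · exact hy
    · exact M.subset_closure_of_subset' (Set.subset_insert x P) hPE hz
  have hry : M.eRk (insert y P) = M.eRk P + 1 :=
    M.eRk_insert_eq_add_one (by rw [hP]; exact ⟨hyE, hyP⟩)
  have hrx : M.eRk (insert x P) = M.eRk P + 1 :=
    M.eRk_insert_eq_add_one (by rw [hP]; exact ⟨hx, hxP⟩)
  refine le_antisymm hsub ?_
  intro z hz
  by_contra hzc
  have hzE : z ∈ M.E := M.closure_subset_ground _ hz
  have h1 : M.eRk (insert z (M.closure (insert y P))) = M.eRk (M.closure (insert y P)) + 1 :=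
    M.eRk_insert_eq_add_one (by rw [M.closure_closure]; exact ⟨hzE, hzc⟩)
  have h2 : M.eRk (insert z (M.closure (insert y P))) ≤ M.eRk (M.closure (insert x P)) :=
    M.eRk_mono (Set.insert_subset hz hsub)
  rw [h1, M.eRk_closure_eq, M.eRk_closure_eq, hry, hrx] at h2
  obtain ⟨r, hr⟩ := ENat.ne_top_iff_exists.1 (eRk_ne_top_of_finite hPE)
  rw [← hr] at h2
  norm_cast at h2
  omega

/-- **The rank of `P ∪ S` grows by at most the number of distinct closures `cl(P ∪ x)`, `x ∈ S`.** -/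
theorem eRk_union_le_eRk_add_card_image [M.Finite] [DecidableEq (Set α)] (P : Set α)
    (S : Finset α) (hS : (S : Set α) ⊆ M.E) :
    M.eRk (P ∪ (S : Set α)) ≤ M.eRk P + (S.image (fun x => M.closure (insert x P))).card := by
  classical
  induction S using Finset.induction_on with
  | empty => simp
  | insert a S haS ih =>
    have haE : a ∈ M.E := hS (Finset.mem_coe.2 (Finset.mem_insert_self a S))
    have hS' : (S : Set α) ⊆ M.E := (Finset.coe_subset.2 (Finset.subset_insert a S)).trans hS
    have ih' := ih hS'
    rw [Finset.coe_insert, Set.union_insert]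
    by_cases hmem : M.closure (insert a P) ∈ S.image (fun x => M.closure (insert x P))
    · rw [Finset.image_insert, Finset.insert_eq_of_mem hmem]
      obtain ⟨b, hbS, hb⟩ := Finset.mem_image.1 hmem
      have ha : a ∈ M.closure (P ∪ (S : Set α)) := by
        have h1 : a ∈ M.closure (insert a P) := M.mem_closure_of_mem' (Set.mem_insert a P) haE
        rw [← hb] at h1
        refine M.closure_subset_closure ?_ h1
        intro z hz
        rcases hz with rfl | hz
        · exact Or.inr (Finset.mem_coe.2 hbS)
        · exact Or.inl hz
      calc M.eRk (insert a (P ∪ (S : Set α))) = M.eRk (M.closure (insert a (P ∪ (S : Set α)))) :=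
            (M.eRk_closure_eq _).symm
        _ = M.eRk (M.closure (P ∪ (S : Set α))) := by rw [M.closure_insert_eq_of_mem_closure ha]
        _ = M.eRk (P ∪ (S : Set α)) := M.eRk_closure_eq _
        _ ≤ _ := ih'
    · rw [Finset.image_insert, Finset.card_insert_of_notMem hmem]
      calc M.eRk (insert a (P ∪ (S : Set α))) ≤ M.eRk (P ∪ (S : Set α)) + 1 := M.eRk_insert_le_add_one _ _
        _ ≤ M.eRk P + (S.image (fun x => M.closure (insert x P))).card + 1 := add_le_add ih' le_rfl
        _ = _ := by push_cast; ring

/-- **THE MAXIMAL EXTENSIONS OF A FLAT, IN BLOCKS**: for a flat `P` of rank `r` with `q = |P|` on a matroid of rank `p` and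
`p + d` points, `#{x ∈ E ∖ P : |cl(P ∪ x)| = f} = t·(f − q)` for some `t` with `t·(f − q − 1) ≤ d + r − q`. -/
theorem card_maxExt_eq_mul [M.Finite] {p d r : ℕ} (hR : M.eRank = (p : ℕ∞)) (hn : M.E.ncard = p + d)
    {P : Set α} (hPE : P ⊆ M.E) (hP : M.closure P = P) (hPr : M.eRk P = (r : ℕ∞)) (f : ℕ) :
    ∃ t : ℕ, ({x ∈ M.E \ P | (M.closure (insert x P)).ncard = f}).ncard = t * (f - P.ncard) ∧ t * (f - P.ncard - 1) ≤ d + r - P.ncard := by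
  classical
  have hPfin : P.Finite := M.ground_finite.subset hPE
  have hTfin : ({x ∈ M.E \ P | (M.closure (insert x P)).ncard = f}).Finite := M.ground_finite.subset (maxExt_subset_ground P f)
  set T : Finset α := hTfin.toFinset with hTdef
  set g : α → Set α := fun x => M.closure (insert x P) with hgdef
  have hmemT : ∀ x, x ∈ T ↔ x ∈ {x ∈ M.E \ P | (M.closure (insert x P)).ncard = f} := fun x => by rw [hTdef, Set.Finite.mem_toFinset]
  -- the block of `x ∈ T` is `g x ∖ P`
  have hblock : ∀ x ∈ T, ((T.filter (fun y => g y = g x)) : Set α) = g x \ P := by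
    intro x hx
    obtain ⟨hxE, hxP, hxf⟩ := mem_maxExt.1 ((hmemT x).1 hx)
    ext y
    rw [Finset.coe_filter, Set.mem_setOf_eq, Set.mem_sdiff, hmemT, mem_maxExt]
    constructor
    · rintro ⟨⟨hyE, hyP, -⟩, hgy⟩
      refine ⟨?_, hyP⟩
      rw [← hgy]
      exact M.mem_closure_of_mem' (Set.mem_insert y P) hyE
    · rintro ⟨hyg, hyP⟩
      have hyE : y ∈ M.E := M.closure_subset_ground _ hyg
      have hg : g y = g x := closure_insert_eq_of_mem_closure_insert hPE hP hxE hxP hyg hyP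
      exact ⟨⟨hyE, hyP, by rw [show M.closure (insert y P) = g y from rfl, hg]; exact hxf⟩, hg⟩
  have hblockcard : ∀ x ∈ T, (T.filter (fun y => g y = g x)).card = f - P.ncard := by
    intro x hx
    obtain ⟨-, -, hxf⟩ := mem_maxExt.1 ((hmemT x).1 hx)
    have h1 : (T.filter (fun y => g y = g x)).card = ((T.filter (fun y => g y = g x)) : Set α).ncard :=
      (Set.ncard_coe_finset _).symm
    rw [h1, hblock x hx, Set.ncard_sdiff (M.subset_closure_of_subset' (Set.subset_insert x P) hPE) hPfin]
    rw [show (g x).ncard = f from hxf]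
  -- `#T = t·(f − q)` with `t` the number of blocks
  set t : ℕ := (T.image g).card with htdef
  have hTcard : T.card = t * (f - P.ncard) := by
    rw [Finset.card_eq_sum_card_image g T]
    rw [Finset.sum_congr rfl (fun F hF => ?_), Finset.sum_const, smul_eq_mul]
    obtain ⟨x, hx, rfl⟩ := Finset.mem_image.1 hF
    exact hblockcard x hx
  refine ⟨t, by rw [Set.ncard_eq_toFinset_card _ hTfin]; exact hTcard, ?_⟩
  -- the rank of `P ∪ T` is at most `r + t`
  have hTE : (T : Set α) ⊆ M.E := fun x hx => (mem_maxExt.1 ((hmemT x).1 (Finset.mem_coe.1 hx))).1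
  have hrank : M.eRk (P ∪ (T : Set α)) ≤ (r + t : ℕ) := by
    have := eRk_union_le_eRk_add_card_image P T hTE
    rw [hPr] at this
    push_cast
    exact this
  -- the nullity of `P ∪ T` is at most `d`
  have hPT : P ∪ (T : Set α) ⊆ M.E := Set.union_subset hPE hTE
  have hdisj : Disjoint P (T : Set α) := by
    rw [Set.disjoint_left]
    intro x hxP hxT
    exact (mem_maxExt.1 ((hmemT x).1 (Finset.mem_coe.1 hxT))).2.1 hxP
  have hcardPT : (P ∪ (T : Set α)).ncard = P.ncard + T.card := by
    rw [Set.ncard_union_eq hdisj hPfin (Finset.finite_toSet T), Set.ncard_coe_finset]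
  have hPTle : P.ncard + T.card ≤ p + d := by
    rw [← hcardPT, ← hn]
    exact Set.ncard_le_ncard hPT M.ground_finite
  have hnull : (p : ℕ∞) ≤ (r + t : ℕ) + ((p + d - (P.ncard + T.card) : ℕ) : ℕ∞) := by
    have h1 : M.eRank ≤ M.eRk (P ∪ (T : Set α)) + (M.E \ (P ∪ (T : Set α))).encard := by
      have := M.eRk_union_le_eRk_add_encard (P ∪ (T : Set α)) (M.E \ (P ∪ (T : Set α)))
      rwa [Set.union_sdiff_cancel hPT, M.eRk_ground] at this
    have h2 : (M.E \ (P ∪ (T : Set α))).encard = ((p + d - (P.ncard + T.card) : ℕ) : ℕ∞) := by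
      rw [← (M.ground_finite.subset Set.sdiff_subset).cast_ncard_eq, Set.ncard_sdiff hPT (M.ground_finite.subset hPT), hn, hcardPT]
    rw [hR, h2] at h1
    exact h1.trans (add_le_add hrank le_rfl)
  have hnull' : p ≤ r + t + (p + d - (P.ncard + T.card)) := by exact_mod_cast hnull
  rw [hTcard] at hPTle hnull'
  have hsub : t * (f - P.ncard - 1) = t * (f - P.ncard) - t := by rw [Nat.mul_sub_one]
  rw [hsub]
  generalize t * (f - P.ncard) = X at hPTle hnull' ⊢
  omega

/-- **THE MAXIMAL EXTENSIONS OF A FLAT, COUNTED**: `#{x ∈ E ∖ P : |cl(P ∪ x)| = f} ≤ (f − q)·⌊(d + r − q)/(f − q − 1)⌋`. -/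
theorem card_maxExt_le [M.Finite] {p d r : ℕ} (hR : M.eRank = (p : ℕ∞)) (hn : M.E.ncard = p + d)
    {P : Set α} (hPE : P ⊆ M.E) (hP : M.closure P = P) (hPr : M.eRk P = (r : ℕ∞)) (f : ℕ) (hf : P.ncard + 2 ≤ f) :
    ({x ∈ M.E \ P | (M.closure (insert x P)).ncard = f}).ncard ≤ (f - P.ncard) * ((d + r - P.ncard) / (f - P.ncard - 1)) := by
  obtain ⟨t, ht, htle⟩ := card_maxExt_eq_mul hR hn hPE hP hPr f
  rw [ht, mul_comm]
  apply Nat.mul_le_mul_left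
  exact (Nat.le_div_iff_mul_le (by omega)).2 htle

/-- The trivial bound: `#maxExt P f ≤ |E ∖ P|`. -/
theorem card_maxExt_le_ncard_diff [M.Finite] (P : Set α) (f : ℕ) :
    ({x ∈ M.E \ P | (M.closure (insert x P)).ncard = f}).ncard ≤ (M.E \ P).ncard :=
  Set.ncard_le_ncard (maxExt_subset P f) (M.ground_finite.subset Set.sdiff_subset)

end S2

end PercRepro
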